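import Literature.IUT.LogThetaLattice.BiCoresCompat
import Literature.IUT.LogThetaLattice.HodgeTheaterLogLink
import HarnessLib

/-!
# [IUTchIII] Theorem 1.5 (iii): the bi-coric class of `F^{⊢×μ}_△(^{n,m}D^⊢_△)` (proof-only companion)

S. Mochizuki, *Inter-universal Teichmüller Theory III*, kurims manuscript (May 2020), §1, Theorem 1.5 (iii)
"(Bi-coric `F^{⊢×μ}`-Prime-Strips)", pp. 48–50 (read on the page, own render of the kurims text, p. 49 l. 20 –
p. 50 l. 9) [claim: Mochizuki2012, status: disputed]:

> "Then the poly-isomorphisms of (i) [cf. Remark 1.3.2], (ii) induce, respectively, poly-isomorphisms of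
> `F^{⊢×μ}`-prime-strips `… ⥲ F^{⊢×μ}_△(^{n,m}D_≻) ⥲ F^{⊢×μ}_△(^{n,m+1}D_≻) ⥲ …` [and]
> `… ⥲ F^{⊢×μ}_△(^{n,m}D^⊢_△) ⥲ F^{⊢×μ}_△(^{n+1,m}D^⊢_△) ⥲ …` — where … the collection of isomorphisms that
> constitute the poly-isomorphisms … of the first line of the display is, in general, strictly smaller than
> the collection … of the second line …; the poly-isomorphisms … of the second line … are not full [cf.
> [IUTchII], Remark 1.8.1]. In particular, by composing these isomorphisms, one obtains poly-isomorphisms of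
> `F^{⊢×μ}`-prime-strips `F^{⊢×μ}_△(^{n,m}D^⊢_△) ⥲ F^{⊢×μ}_△(^{n′,m′}D^⊢_△)` for arbitrary `n′, m′ ∈ ℤ`. That is to
> say, in more intuitive terms, the `F^{⊢×μ}`-prime-strip "`^{n,m}F^{⊢×μ}_△(^{n,m}D^⊢_△)`", regarded up to a
> certain class of isomorphisms, is an invariant — which we shall refer to as "bi-coric" — of both the
> horizontal and the vertical arrows of the Gaussian log-theta-lattice. Finally, the Kummer isomorphisms …
> determine Kummer isomorphisms `^{n,m}F^{⊢×μ}_△ ⥲ F^{⊢×μ}_△(^{n,m}D^⊢_△)` which are compatible with the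
> poly-isomorphisms of (ii) …"

Printed proof (p. 51): "The various assertions of Theorem 1.5 follow immediately from the definitions
and the references quoted in the statements of these assertions."

This PROOF-ONLY file (abc-iut cell, DISCHARGE-L6 §F row F12-a, sub-DAG `plan/L6/SUBDAG-IUTchIII-Thm-15.md`
rows Thm-15.iii.r4–r8; no definition, no `Prop` introduced, the typer's files untouched) makes the sentence
"regarded up to a certain class of isomorphisms, is an invariant of both the horizontal and the vertical
arrows" a kernel statement over abc-iut-L6-t3's typing (`BiCores.lean` p406839: `BiCoricData S`,
`verticalPolyIso`, `horizontalPolyIso`, `biCoricPolyIso`; `BiCoresCompat.lean` p408143; `PrimeStripFrame.lean`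
p405060; `HodgeTheaterLogLink.lean` p406456: `LogThetaLatticeDiagram`), using as the ONLY inputs the
interface fields that quote [IUTchII] Cor 4.10 (i) (`dvDelta`, `fxOfDsucc`, `fxOfDsucc_delta`), Cor 4.5 (ii)
(`fxmOfDv`, `fxmOfDv_dv`), Cor 4.6 (i) (`kummer`) and the frame clause "all `D`-`Θ^{±ell}NF`-Hodge theaters
are isomorphic" ([IUTchI] Rmk 6.12.2 (ii); `StripFrame.iso_nonempty_DHT`).

What is PROVED (all unconditional over `B : BiCoricData S`).
1. THE CLASS. The "certain class of isomorphisms" is identified on the nose: for every `ℤ × ℤ`-indexed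
   family of Hodge theaters and all `p q`, the composite bi-coric poly-isomorphism `biCoricPolyIso H p q`
   (vertical step, then horizontal step) EQUALS the poly-isomorphism of all `D^⊢_△`-induced isomorphisms
   `F^{⊢×μ}_△(d)`, `d : ^pD^⊢_△ ⥲ ^qD^⊢_△` (`biCoricPolyIso_eq_horizontalPolyIso`, `mem_biCoricPolyIso_iff`) — so it
   depends only on the two end-points, not on the path or on the intermediate corner
   (`horizontal_comp_vertical_eq_biCoricPolyIso`: horizontal-then-vertical gives the same class), it is
   nonempty (`biCoricPolyIso_nonempty`), contains the identity at `p = q` (`refl_mem_biCoricPolyIso`), is closed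
   under inversion (`biCoricPolyIso_symm`) and under composition along any third lattice point
   (`biCoricPolyIso_comp`: "by composing these isomorphisms, one obtains poly-isomorphisms … for arbitrary
   `n′, m′`") — i.e. the bi-coric strips with these poly-isomorphisms form ONE connected class, the
   invariant of both kinds of arrows. (The first-line/vertical class is contained in it,
   `BiCores.verticalPolyIso_subset`, strictly in general, `StripFrameWitness.two_vertical_ssubset_horizontal`.)
2. BOTH ARROWS LAND IN THE CLASS. In a log-theta-lattice `Λ` (either kind): the poly-isomorphism the
   VERTICAL arrow `(n,m) → (n,m+1)` induces through Thm 1.5 (i) and `†D_≻ ↦ F^{⊢×μ}_△(†D_≻)` lies in the bi-coric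
   class (`LogThetaLatticeDiagram.verticalPolyIso_subset_biCoricPolyIso`), and the poly-isomorphism the
   HORIZONTAL arrow `(n,m) → (n+1,m)` induces through the `D`-`Θ^{±ell}NF`-link [IUTchII, Cor 4.10 (iv)] and
   `†D^⊢_△ ↦ F^{⊢×μ}_△(†D^⊢_△)` IS the bi-coric class (`LogThetaLatticeDiagram.horizontalPolyIso_eq_biCoricPolyIso`).
3. KUMMER COMPATIBILITY FOR ARBITRARY END-POINTS ("compatible with the poly-isomorphisms of (ii)"): the
   bi-coric class between ANY two lattice points lies inside the Kummer transport of the full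
   Frobenius-like poly-isomorphism `^pF^{⊢×μ}_△ ⥲ ^qF^{⊢×μ}_△` (`biCoricPolyIso_subset_kummerTransport`), and the
   `D^⊢`-isomorphism underlying any member of the class is recovered by `dvConj` (`dvConj_mem`).
4. Bookkeeping for the vertical class: it is the image of the FULL poly-isomorphism of `D`-Hodge theaters
   through `†HT^D ↦ †D^⊢_△ ↦ F^{⊢×μ}_△(†D^⊢_△)` (`mem_verticalPolyIso_iff`, `verticalPolyIso_eq_map_map`), nonempty
   (`verticalPolyIso_nonempty`).

Honest framing: every statement is bookkeeping of poly-isomorphisms over the interfaces `StripFrame`,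
`BiCoricData`, `LogThetaLatticeDiagram` (typed ≠ discharged: the printed objects `F^{⊢×μ}_△(−)` are the
interface's functorial algorithms, not constructed here; sub-DAG rows r6/r6a — [IUTchII] Cor 4.5 (iii)
untyped on the [IUTchII] side — and the REAL frame `StripFrame.ofKits` remain with their owners); nothing
here asserts a disputed claim or takes a side on [IUTchIII] Cor. 3.12.
-/

namespace Literature.IUT.LogThetaLattice

open CategoryTheory
open Literature.IUT.HodgeTheaters

universe u

namespace BiCoricData

variable {S : StripFrame.{u}} (B : BiCoricData S)

/-! ### The vertical class (first line of the fifth display of (iii)) -/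

/-- **IUTchIII:Thm1.5(iii)** (kurims p.49) membership in the VERTICAL poly-isomorphism
`F^{⊢×μ}_△(†D^⊢_△) ⥲ F^{⊢×μ}_△(‡D^⊢_△)` (first line of the fifth display): exactly the isomorphisms `F^{⊢×μ}_△(D^⊢_△(Ξ))`
for `Ξ : †HT^D ⥲ ‡HT^D` in the FULL poly-isomorphism of Thm 1.5 (i) (naturality of
`F^{⊢×}_△(†D_≻) ⥲ F^{⊢×}_△(†D^⊢_△)`, `mapIso_eq_conj`). [claim: Mochizuki2012, status: disputed] -/
theorem mem_verticalPolyIso_iff (H H' : S.DHT) (e : B.fxmDeltaOf H ≅ B.fxmDeltaOf H') :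
    e ∈ B.verticalPolyIso H H' ↔ ∃ ξ : H ≅ H', B.fxmOfDv.mapIso (B.dvDelta.mapIso ξ) = e := by
  constructor
  · rintro ⟨f, ⟨a, ha, g, ⟨ξ, -, rfl⟩, rfl⟩, c, hc, rfl⟩
    rw [PolyIso.mem_single] at ha hc
    subst ha; subst hc
    exact ⟨ξ, (B.mapIso_eq_conj ξ).symm.trans (Iso.trans_assoc _ _ _).symm⟩
  · rintro ⟨ξ, rfl⟩
    refine ⟨(B.deltaIso H).symm ≪≫ B.fxOfDsucc.mapIso ((S.dstrip B.succ).mapIso ξ),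
      ⟨(B.deltaIso H).symm, PolyIso.mem_single.mpr rfl, B.fxOfDsucc.mapIso ((S.dstrip B.succ).mapIso ξ),
        PolyIso.mem_map.mpr ⟨ξ, PolyIso.mem_full ξ, rfl⟩, rfl⟩,
      B.deltaIso H', PolyIso.mem_single.mpr rfl, ?_⟩
    exact (Iso.trans_assoc _ _ _).trans (B.mapIso_eq_conj ξ)

/-- **IUTchIII:Thm1.5(iii)** (kurims p.49) hence the vertical class is the image of the FULL poly-isomorphism of
`D`-`Θ^{±ell}NF`-Hodge theaters `†HT^D ⥲ ‡HT^D` (Thm 1.5 (i)) through `†HT^D ↦ †D^⊢_△` and then `†D^⊢ ↦ F^{⊢×μ}_△(†D^⊢)`.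
[claim: Mochizuki2012, status: disputed] -/
theorem verticalPolyIso_eq_map_map (H H' : S.DHT) :
    B.verticalPolyIso H H' = ((PolyIso.full H H').map B.dvDelta).map B.fxmOfDv := by
  ext e
  rw [B.mem_verticalPolyIso_iff]
  simp only [PolyIso.mem_map, PolyIso.mem_full, true_and]
  constructor
  · rintro ⟨ξ, rfl⟩
    exact ⟨_, ⟨ξ, rfl⟩, rfl⟩
  · rintro ⟨_, ⟨ξ, rfl⟩, rfl⟩
    exact ⟨ξ, rfl⟩

/-- **IUTchIII:Thm1.5(iii)** (kurims p.49) the vertical class is nonempty — all `D`-`Θ^{±ell}NF`-Hodge theaters of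
the frame are isomorphic ([IUTchI] Rmk 6.12.2 (ii), `StripFrame.iso_nonempty_DHT`). [claim: Mochizuki2012, status: disputed] -/
theorem verticalPolyIso_nonempty (H H' : S.DHT) : (B.verticalPolyIso H H').Nonempty := by
  obtain ⟨ξ⟩ := S.iso_nonempty_DHT H H'
  exact ⟨_, (B.mem_verticalPolyIso_iff H H' _).mpr ⟨ξ, rfl⟩⟩

/-! ### The horizontal(-type) class (second line of the fifth display of (iii)) is a groupoid class -/

/-- **IUTchIII:Thm1.5(iii)** (kurims p.49) any two `D^⊢_△`'s of the frame are isomorphic (through `†HT^D ↦ †D^⊢_△`).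
[claim: Mochizuki2012, status: disputed] -/
theorem dvDeltaOf_iso_nonempty (H H' : S.DHT) : Nonempty (B.dvDeltaOf H ≅ B.dvDeltaOf H') := by
  obtain ⟨ξ⟩ := S.iso_nonempty_DHT H H'
  exact ⟨B.dvDelta.mapIso ξ⟩

/-- **IUTchIII:Thm1.5(iii)** (kurims p.49) the `D^⊢_△`-induced class is nonempty. [claim: Mochizuki2012, status: disputed] -/
theorem horizontalPolyIso_nonempty (H H' : S.DHT) : (B.horizontalPolyIso H H').Nonempty := by
  obtain ⟨d⟩ := B.dvDeltaOf_iso_nonempty H H'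
  exact ⟨_, (B.mem_horizontalPolyIso H H' _).mpr ⟨d, rfl⟩⟩

/-- **IUTchIII:Thm1.5(iii)** (kurims p.49) the identity lies in the `D^⊢_△`-induced class of a strip with itself.
[claim: Mochizuki2012, status: disputed] -/
theorem refl_mem_horizontalPolyIso (H : S.DHT) : Iso.refl _ ∈ B.horizontalPolyIso H H :=
  (B.mem_horizontalPolyIso H H _).mpr ⟨Iso.refl _, B.fxmOfDv.mapIso_refl _⟩

/-- **IUTchIII:Thm1.5(iii)** (kurims p.49) the `D^⊢_△`-induced class is closed under inversion.
[claim: Mochizuki2012, status: disputed] -/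
theorem horizontalPolyIso_symm (H H' : S.DHT) :
    (B.horizontalPolyIso H H').symm = B.horizontalPolyIso H' H := by
  ext e
  simp only [PolyIso.symm, Set.mem_image]
  constructor
  · rintro ⟨f, hf, rfl⟩
    obtain ⟨d, rfl⟩ := (B.mem_horizontalPolyIso H H' f).mp hf
    exact (B.mem_horizontalPolyIso H' H _).mpr ⟨d.symm, B.fxmOfDv.mapIso_symm d⟩
  · intro he
    obtain ⟨d, rfl⟩ := (B.mem_horizontalPolyIso H' H e).mp he
    exact ⟨B.fxmOfDv.mapIso d.symm, (B.mem_horizontalPolyIso H H' _).mpr ⟨d.symm, rfl⟩,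
      by rw [Functor.mapIso_symm, Iso.symm_symm_eq]⟩

/-- **IUTchIII:Thm1.5(iii)** (kurims p.49) "by composing these isomorphisms": the composite of the `D^⊢_△`-induced
classes through any intermediate strip is the `D^⊢_△`-induced class. [claim: Mochizuki2012, status: disputed] -/
theorem horizontalPolyIso_comp (H H' H'' : S.DHT) :
    (B.horizontalPolyIso H H').comp (B.horizontalPolyIso H' H'') = B.horizontalPolyIso H H'' := by
  ext e
  rw [PolyIso.mem_comp]
  constructor
  · rintro ⟨f, hf, g, hg, rfl⟩
    obtain ⟨d, rfl⟩ := (B.mem_horizontalPolyIso H H' f).mp hf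
    obtain ⟨d', rfl⟩ := (B.mem_horizontalPolyIso H' H'' g).mp hg
    exact (B.mem_horizontalPolyIso H H'' _).mpr ⟨d ≪≫ d', B.fxmOfDv.mapIso_trans d d'⟩
  · intro he
    obtain ⟨d, rfl⟩ := (B.mem_horizontalPolyIso H H'' e).mp he
    obtain ⟨d₀⟩ := B.dvDeltaOf_iso_nonempty H H'
    refine ⟨B.fxmOfDv.mapIso d₀, (B.mem_horizontalPolyIso H H' _).mpr ⟨d₀, rfl⟩,
      B.fxmOfDv.mapIso (d₀.symm ≪≫ d), (B.mem_horizontalPolyIso H' H'' _).mpr ⟨d₀.symm ≪≫ d, rfl⟩, ?_⟩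
    rw [← B.fxmOfDv.mapIso_trans, ← Iso.trans_assoc, Iso.self_symm_id, Iso.refl_trans]

/-- **IUTchIII:Thm1.5(iii)** (kurims p.49) composing the VERTICAL class with the `D^⊢_△`-induced class through any
intermediate `D`-Hodge theater gives the `D^⊢_△`-induced class (first line ⊆ second line, then `horizontalPolyIso_comp`).
[claim: Mochizuki2012, status: disputed] -/
theorem verticalPolyIso_comp_horizontalPolyIso (H H' H'' : S.DHT) :
    (B.verticalPolyIso H H').comp (B.horizontalPolyIso H' H'') = B.horizontalPolyIso H H'' := by
  refine Set.Subset.antisymm ?_ ?_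
  · rw [← B.horizontalPolyIso_comp H H' H'']
    exact Set.image2_subset_right (B.verticalPolyIso_subset H H')
  · intro e he
    obtain ⟨d, rfl⟩ := (B.mem_horizontalPolyIso H H'' e).mp he
    obtain ⟨ξ⟩ := S.iso_nonempty_DHT H H'
    refine PolyIso.mem_comp.mpr ⟨B.fxmOfDv.mapIso (B.dvDelta.mapIso ξ),
      (B.mem_verticalPolyIso_iff H H' _).mpr ⟨ξ, rfl⟩, B.fxmOfDv.mapIso ((B.dvDelta.mapIso ξ).symm ≪≫ d),
      (B.mem_horizontalPolyIso H' H'' _).mpr ⟨_, rfl⟩, ?_⟩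
    rw [← B.fxmOfDv.mapIso_trans, ← Iso.trans_assoc, Iso.self_symm_id, Iso.refl_trans]

/-- **IUTchIII:Thm1.5(iii)** (kurims p.49) the other order: the `D^⊢_△`-induced class followed by the vertical class is
again the `D^⊢_△`-induced class. [claim: Mochizuki2012, status: disputed] -/
theorem horizontalPolyIso_comp_verticalPolyIso (H H' H'' : S.DHT) :
    (B.horizontalPolyIso H H').comp (B.verticalPolyIso H' H'') = B.horizontalPolyIso H H'' := by
  refine Set.Subset.antisymm ?_ ?_
  · rw [← B.horizontalPolyIso_comp H H' H'']
    exact Set.image2_subset_left (B.verticalPolyIso_subset H' H'')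
  · intro e he
    obtain ⟨d, rfl⟩ := (B.mem_horizontalPolyIso H H'' e).mp he
    obtain ⟨ξ⟩ := S.iso_nonempty_DHT H' H''
    refine PolyIso.mem_comp.mpr ⟨B.fxmOfDv.mapIso (d ≪≫ (B.dvDelta.mapIso ξ).symm),
      (B.mem_horizontalPolyIso H H' _).mpr ⟨_, rfl⟩, B.fxmOfDv.mapIso (B.dvDelta.mapIso ξ),
      (B.mem_verticalPolyIso_iff H' H'' _).mpr ⟨ξ, rfl⟩, ?_⟩
    rw [← B.fxmOfDv.mapIso_trans, Iso.trans_assoc, Iso.symm_self_id, Iso.trans_refl]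

/-! ### The bi-coric class for a `ℤ × ℤ`-family: "an invariant of both the horizontal and the vertical arrows" -/

variable (H : ℤ × ℤ → S.HT)

/-- **IUTchIII:Thm1.5(iii)** (kurims p.50) "the `F^{⊢×μ}`-prime-strip `^{n,m}F^{⊢×μ}_△(^{n,m}D^⊢_△)`, regarded up to a
certain class of isomorphisms, is an invariant — bi-coric — of both the horizontal and the vertical arrows":
the composite bi-coric poly-isomorphism between the lattice points `p`, `q` IS the class of all
`D^⊢_△`-induced isomorphisms `F^{⊢×μ}_△(^pD^⊢_△) ⥲ F^{⊢×μ}_△(^qD^⊢_△)` — independent of the vertical leg used to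
define it. [claim: Mochizuki2012, status: disputed] -/
theorem biCoricPolyIso_eq_horizontalPolyIso (p q : ℤ × ℤ) :
    B.biCoricPolyIso H p q = B.horizontalPolyIso (S.htToD.obj (H p)) (S.htToD.obj (H q)) :=
  B.verticalPolyIso_comp_horizontalPolyIso _ _ _

/-- **IUTchIII:Thm1.5(iii)** (kurims p.50) membership in the bi-coric class: exactly the `D^⊢_△`-induced
isomorphisms. [claim: Mochizuki2012, status: disputed] -/
theorem mem_biCoricPolyIso_iff (p q : ℤ × ℤ)
    (e : B.fxmDeltaOf (S.htToD.obj (H p)) ≅ B.fxmDeltaOf (S.htToD.obj (H q))) :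
    e ∈ B.biCoricPolyIso H p q ↔
      ∃ d : B.dvDeltaOf (S.htToD.obj (H p)) ≅ B.dvDeltaOf (S.htToD.obj (H q)), B.fxmOfDv.mapIso d = e := by
  rw [biCoricPolyIso_eq_horizontalPolyIso, mem_horizontalPolyIso]

/-- **IUTchIII:Thm1.5(iii)** (kurims p.50) the bi-coric class between any two lattice points is nonempty.
[claim: Mochizuki2012, status: disputed] -/
theorem biCoricPolyIso_nonempty (p q : ℤ × ℤ) : (B.biCoricPolyIso H p q).Nonempty := by
  rw [biCoricPolyIso_eq_horizontalPolyIso]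
  exact B.horizontalPolyIso_nonempty _ _

/-- **IUTchIII:Thm1.5(iii)** (kurims p.50) the identity belongs to the bi-coric class of a lattice point with itself.
[claim: Mochizuki2012, status: disputed] -/
theorem refl_mem_biCoricPolyIso (p : ℤ × ℤ) : Iso.refl _ ∈ B.biCoricPolyIso H p p := by
  rw [biCoricPolyIso_eq_horizontalPolyIso]
  exact B.refl_mem_horizontalPolyIso _

/-- **IUTchIII:Thm1.5(iii)** (kurims p.50) the bi-coric class is closed under inversion (`p ⥲ q` inverted is `q ⥲ p`).
[claim: Mochizuki2012, status: disputed] -/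
theorem biCoricPolyIso_symm (p q : ℤ × ℤ) : (B.biCoricPolyIso H p q).symm = B.biCoricPolyIso H q p := by
  rw [biCoricPolyIso_eq_horizontalPolyIso, biCoricPolyIso_eq_horizontalPolyIso]
  exact B.horizontalPolyIso_symm _ _

/-- **IUTchIII:Thm1.5(iii)** (kurims p.49–50) "by composing these isomorphisms, one obtains poly-isomorphisms
… `F^{⊢×μ}_△(^{n,m}D^⊢_△) ⥲ F^{⊢×μ}_△(^{n′,m′}D^⊢_△)` for arbitrary `n′, m′`": composing the bi-coric classes `p ⥲ q`
and `q ⥲ r` through ANY intermediate lattice point `q` gives the bi-coric class `p ⥲ r` (path independence).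
[claim: Mochizuki2012, status: disputed] -/
theorem biCoricPolyIso_comp (p q r : ℤ × ℤ) :
    (B.biCoricPolyIso H p q).comp (B.biCoricPolyIso H q r) = B.biCoricPolyIso H p r := by
  simp only [biCoricPolyIso_eq_horizontalPolyIso]
  exact B.horizontalPolyIso_comp _ _ _

/-- **IUTchIII:Thm1.5(iii)** (kurims p.49–50) independence of the intermediate corner: the HORIZONTAL step
`p → (q.1, p.2)` followed by the VERTICAL step `(q.1, p.2) → q` yields the same class as `biCoricPolyIso`
(vertical-then-horizontal). [claim: Mochizuki2012, status: disputed] -/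
theorem horizontal_comp_vertical_eq_biCoricPolyIso (p q : ℤ × ℤ) :
    (B.horizontalPolyIso (S.htToD.obj (H p)) (S.htToD.obj (H (q.1, p.2)))).comp
        (B.verticalPolyIso (S.htToD.obj (H (q.1, p.2))) (S.htToD.obj (H q))) =
      B.biCoricPolyIso H p q := by
  rw [biCoricPolyIso_eq_horizontalPolyIso]
  exact B.horizontalPolyIso_comp_verticalPolyIso _ _ _

/-- **IUTchIII:Thm1.5(iii)** (kurims p.50) the bi-coric class depends on the family only through the two
end-points: re-indexing the family (e.g. by the translation symmetries of the lattice) does not change it.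
[claim: Mochizuki2012, status: disputed] -/
theorem biCoricPolyIso_reindex (σ : ℤ × ℤ → ℤ × ℤ) (p q : ℤ × ℤ) :
    B.biCoricPolyIso (H ∘ σ) p q = B.biCoricPolyIso H (σ p) (σ q) := by
  rw [biCoricPolyIso_eq_horizontalPolyIso, biCoricPolyIso_eq_horizontalPolyIso]
  rfl

/-- **IUTchIII:Thm1.5(iii)** (kurims p.50) "Kummer isomorphisms … compatible with the poly-isomorphisms of (ii)",
for ARBITRARY end-points: the bi-coric class `p ⥲ q` lies inside the Kummer transport of the full
Frobenius-like poly-isomorphism `^pF^{⊢×μ}_△ ⥲ ^qF^{⊢×μ}_△` (`BiCoresCompat.kummerTransport_image_full`).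
[claim: Mochizuki2012, status: disputed] -/
theorem biCoricPolyIso_subset_kummerTransport (p q : ℤ × ℤ) :
    B.biCoricPolyIso H p q ⊆
      B.kummerTransport '' (PolyIso.full (B.fxmDeltaHT.obj (H p)) (B.fxmDeltaHT.obj (H q))) := by
  rw [biCoricPolyIso_eq_horizontalPolyIso]
  exact B.horizontalPolyIso_subset_kummerTransport (H p) (H q)

/-- **IUTchIII:Thm1.5(iii)** (kurims p.50) the `D^⊢`-isomorphism underlying a member of the bi-coric class is the
one inducing it (`BiCoresCompat.dvConj_mapIso`): `F^{⊢×μ}_△(dvConj e) = e`. [claim: Mochizuki2012, status: disputed] -/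
theorem mapIso_dvConj_of_mem (p q : ℤ × ℤ)
    {e : B.fxmDeltaOf (S.htToD.obj (H p)) ≅ B.fxmDeltaOf (S.htToD.obj (H q))} (he : e ∈ B.biCoricPolyIso H p q) :
    B.fxmOfDv.mapIso (B.dvConj e) = e := by
  obtain ⟨d, rfl⟩ := (B.mem_biCoricPolyIso_iff H p q e).mp he
  rw [B.dvConj_mapIso]

end BiCoricData

/-! ### In a log-theta-lattice: both kinds of arrows land in the bi-coric class -/

namespace LogThetaLatticeDiagram

variable {S : StripFrame.{u}} {L : LogStripData S} {T : ThetaLinkData S}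
  (Λ : LogThetaLatticeDiagram L T) (B : BiCoricData S)

/-- **IUTchIII:Thm1.5(iii)** (kurims p.49) in a log-theta-lattice (either kind) the poly-isomorphism
`F^{⊢×μ}_△(^{n,m}D^⊢_△) ⥲ F^{⊢×μ}_△(^{n,m+1}D^⊢_△)` induced by the VERTICAL arrow `(n,m) → (n,m+1)` through Thm 1.5 (i)
(`vertical_inducedDHT`, a full poly-isomorphism) and `†D_≻ ↦ F^{⊢×μ}_△(†D_≻)` lies in the bi-coric class — the
first line of the fifth display of (iii) inside the second. [claim: Mochizuki2012, status: disputed] -/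
theorem verticalPolyIso_subset_biCoricPolyIso (n m : ℤ) :
    B.verticalPolyIso (S.htToD.obj (Λ.HT (n, m))) (S.htToD.obj (Λ.HT (n, m + 1))) ⊆
      B.biCoricPolyIso Λ.HT (n, m) (n, m + 1) := by
  rw [B.biCoricPolyIso_eq_horizontalPolyIso]
  exact B.verticalPolyIso_subset _ _

/-- **IUTchIII:Thm1.5(iii)** (kurims p.49) the vertical arrow's poly-isomorphism of Thm 1.5 (i), pushed through
`†HT^D ↦ F^{⊢×μ}_△(†D^⊢_△)`, lies in the bi-coric class (same statement read off the ARROW `Λ.vertical n m`).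
[claim: Mochizuki2012, status: disputed] -/
theorem vertical_inducedDHT_map_subset_biCoricPolyIso (n m : ℤ) :
    (((Λ.vertical n m).inducedDHT).map B.dvDelta).map B.fxmOfDv ⊆ B.biCoricPolyIso Λ.HT (n, m) (n, m + 1) := by
  rw [Λ.vertical_inducedDHT_full, ← B.verticalPolyIso_eq_map_map]
  exact Λ.verticalPolyIso_subset_biCoricPolyIso B n m

/-- **IUTchIII:Thm1.5(iii)** (kurims p.49) in a log-theta-lattice the poly-isomorphism
`F^{⊢×μ}_△(^{n,m}D^⊢_△) ⥲ F^{⊢×μ}_△(^{n+1,m}D^⊢_△)` induced by the HORIZONTAL arrow `(n,m) → (n+1,m)` through the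
`D`-`Θ^{±ell}NF`-link (the FULL poly-isomorphism `^{n,m}D^⊢_△ ⥲ ^{n+1,m}D^⊢_△`, [IUTchII] Cor 4.10 (iv)) and
`†D^⊢_△ ↦ F^{⊢×μ}_△(†D^⊢_△)` IS the bi-coric class. [claim: Mochizuki2012, status: disputed] -/
theorem horizontalPolyIso_eq_biCoricPolyIso (n m : ℤ) :
    B.horizontalPolyIso (S.htToD.obj (Λ.HT (n, m))) (S.htToD.obj (Λ.HT (n + 1, m))) =
      B.biCoricPolyIso Λ.HT (n, m) (n + 1, m) :=
  (B.biCoricPolyIso_eq_horizontalPolyIso Λ.HT (n, m) (n + 1, m)).symm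

/-- **IUTchIII:Thm1.5(iii)** (kurims p.50) in a log-theta-lattice the Kummer transport of the FULL poly-isomorphism
`^{n,m}F^{⊢×μ}_△ ⥲ ^{n+1,m}F^{⊢×μ}_△` that the horizontal arrow induces on the Frobenius-like strips (Thm 1.5 (ii),
`horizontal_inducedFxm_full`, read on `BiCores`' copy `fxmDeltaHT` of `†HT ↦ †F^{⊢×μ}_△`) CONTAINS the bi-coric class
`(n,m) ⥲ (n+1,m)` — "compatible with the poly-isomorphisms of (ii)". [claim: Mochizuki2012, status: disputed] -/
theorem biCoricPolyIso_subset_kummerTransport_horizontal (n m : ℤ) :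
    B.biCoricPolyIso Λ.HT (n, m) (n + 1, m) ⊆
      B.kummerTransport '' (PolyIso.full (B.fxmDeltaHT.obj (Λ.HT (n, m))) (B.fxmDeltaHT.obj (Λ.HT (n + 1, m)))) :=
  B.biCoricPolyIso_subset_kummerTransport Λ.HT (n, m) (n + 1, m)

/-- **IUTchIII:Thm1.5(iii)** (kurims p.50) "is an invariant … of both the horizontal and the vertical arrows": for ALL
pairs of lattice points the bi-coric class is one and the same `D^⊢_△`-induced class, nonempty, containing the
identities, closed under inversion and composition — the kernel form of "regarded up to a certain class of
isomorphisms, is an invariant". [claim: Mochizuki2012, status: disputed] -/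
theorem thm15iii_biCoric (p q r : ℤ × ℤ) :
    B.biCoricPolyIso Λ.HT p q = B.horizontalPolyIso (S.htToD.obj (Λ.HT p)) (S.htToD.obj (Λ.HT q)) ∧
    (B.biCoricPolyIso Λ.HT p q).Nonempty ∧
    Iso.refl _ ∈ B.biCoricPolyIso Λ.HT p p ∧
    (B.biCoricPolyIso Λ.HT p q).symm = B.biCoricPolyIso Λ.HT q p ∧
    (B.biCoricPolyIso Λ.HT p q).comp (B.biCoricPolyIso Λ.HT q r) = B.biCoricPolyIso Λ.HT p r :=
  ⟨B.biCoricPolyIso_eq_horizontalPolyIso Λ.HT p q, B.biCoricPolyIso_nonempty Λ.HT p q,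
    B.refl_mem_biCoricPolyIso Λ.HT p, B.biCoricPolyIso_symm Λ.HT p q, B.biCoricPolyIso_comp Λ.HT p q r⟩

end LogThetaLatticeDiagram

end Literature.IUT.LogThetaLattice
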